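import Summits.QuantumFields.BalabanUV.T4Continuum.Spine.NE3.SlicB8LandauMinimal
import HarnessLib

/-!
# T⁴ programme, node NE3 — census R32 (exact half, step 1b): THE EXACT PART OF A (1.38)-LANDAU DIRECTION IS CONTROLLED BY ANY COMPETITOR WITH THE SAME
# NESTED BLOCK MEANS — `Σ‖D_W ζ‖² ≤ 2·Σ‖D_W ũ‖² + 32·(L^{j+1})²·Σ‖Δ_W ũ‖²` — so the flat (P♮) on `slicB8` for `N ≥ 2` is REDUCED to ONE interpolation lemma

Cell `pub-balaban-gaps` (track G2, seat `ne3`; writer prover-pub-balaban-gaps-ne3-g5-0, 2026-08-23), census `run/shared/lean/pub/pub-balaban-gaps/ne/NE3.md` §4 R32 ∕ §11.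
WHAT.  `SlicB8LandauMinimal` (p363071) reads [Balaban1985RegularSpaces] (1.38) on the Hodge potential `ζ` of `Y = η + D_W ζ`: `Δ_W ζ` is `hsR`-orthogonal to `Δ_W N(Q′(W))`
and minimises `Σ‖Δ_W(ζ + μ)‖²` over the restricted gauge algebra `μ ∈ N(Q′(W)) = avgKernelGauges L N (j+1) W`.  THIS FILE adds the corner-gauge Poincaré inequality of
`N(Q′(W))` (K6-Ξ, `NE3CornerGaugePoincare.sum_nhsNormSq_le_four_mul_of_bmeanIterW_eq_zero`, in the tower's small-field class) and concludes:
(i) **`sum_nhsNormSq_gaugeDir_le_of_mem_avgKernelGauges`** — for `μ ∈ N(Q′(W))`: `Σ_{x,κ} nhsNormSq (D_W μ) ≤ 4·(L^{j+1})²·Σ_x nhsNormSq (Δ_W μ)` (the gradient of a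
restricted generator is controlled by its covariant Laplacian: `‖Dμ‖² = ⟨Δμ, μ⟩ ≤ ‖Δμ‖·‖μ‖ ≤ ‖Δμ‖·2M‖Dμ‖`);
(ii) **`sum_nhsNormSq_gaugeDir_le_of_isLandauB8`** — for a (1.38)-Landau `Y = η + D_W ζ` (`covDiv W η = 0` on the box) and ANY `ũ` with `ũ − ζ ∈ N(Q′(W))` (same skew-periodic
class, same nested transported block means): `Σ_{x,κ} nhsNormSq (D_W ζ) ≤ 2·Σ_{x,κ} nhsNormSq (D_W ũ) + 32·(L^{j+1})²·Σ_x nhsNormSq (Δ_W ũ)` over `periodBox (N·L^{j+1})`.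
CONSEQUENCE (census R32).  At the flat background the exact part of `Y ∈ slicB8(1)` is bounded by the Dirichlet and Laplacian energies of ANY block-mean interpolant `ũ` of
the nested block means `q` of `ζ` — so the flat, N-free slice Poincaré inequality on `slicB8` for `N ≥ 2` follows from ONE interpolation lemma (a C¹ interpolant with
`‖dũ‖² ≲ M^{d−2}‖∇_c q‖²`, `‖Δũ‖² ≲ M^{d−4}‖∇_c q‖²`), the co-closed half `SlicB8FlatCoexact` (p362018) and the tree's S-bound on `Q_k(Y^co)`; that lemma is NOT in this file.

CONTENT (0 sorry, no `def`): **`sum_nhsNormSq_gaugeDir_le_of_mem_avgKernelGauges`**, **`sum_nhsNormSq_gaugeDir_le_of_isLandauB8`** [folklore].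

HONEST FRAMING.  Linear algebra + the tree's K6-Ξ inequality on OUR typing of (1.38), every unitary periodic background of the small-field class; nothing of Bałaban's is
proved; (P♮) on `slicB8` and **NE3 are NOT proved**; spine PROVED 0∕9; finite T⁴ rung (B)+1 — NOT continuum YM on ℝ⁴, NOT infinite volume, NOT mass gap, NOT Clay.
PLACEMENT: `Summits/QuantumFields/BalabanUV/T4Continuum/Spine/NE3/`.
-/

set_option autoImplicit false

open scoped BigOperators Matrix Matrix.Norms.L2Operator
open Finset

namespace Summit.QuantumFields.BalabanUV.T4Continuum.NE3.SlicB8LandauReduction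

open Literature.MathematicalPhysics.QuantumFieldTheory.Balaban1983to89
open B7Prop1Explicit B7Prop2Explicit MatrixNorms
open T4AveragingDeficitWall (Ad IsUnitaryCfg IsSkewDir SmallField)
open T4AveragingDeficitWallBoundary (IsPeriodicCfg periodBox mem_periodBox)
open AveragingDeficitPeriodicCounting (IsPeriodicDir)
open AveragingDeficitMultiLevelPrep (LevelSmall)
open AveragingDeficitTwoLevelPrep (prop1Radius)
open SpreadLift (loopRad)
open BlockAveragePushDirGauge (gaugeDir isPeriodicDir_gaugeDir)
open NE3CovariantCalculus (hsR hsR_self hsR_comm nhsNormSq_sub_le)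
open NE3CovariantWeitzenbock (covDiv)
open NE3LandauOrbit (sum_hsR_gaugeDir covDiv_add_period nhsNormSq_add)
open NE3CovariantSBound (abs_hsR_le_nhsNorm)
open NE3CurvedCornerGaugeSpace (gaugeDir_add_pi)
open NE3CornerGaugePoincare (sum_nhsNormSq_le_four_mul_of_bmeanIterW_eq_zero)
open NE3.PairLandauB8 (avgKernelGauges covLapSite IsLandauB8)
open NE3.LandauProjectionB8 (covDiv_gaugeDir_eq_covLapSite covLapSite_add covLapSite_add_period)
open NE3.SlicB8LandauMinimal (sum_nhsNormSq_covLapSite_le_of_isLandauB8)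

noncomputable section

variable {d : ℕ} {n : Type*} [Fintype n] [DecidableEq n]

/-- **THE GRADIENT OF A RESTRICTED GENERATOR IS CONTROLLED BY ITS COVARIANT LAPLACIAN** (module docstring (i)): in the tower's small-field class, for
`μ ∈ avgKernelGauges L N (j+1) W`, `Σ_{x,κ} nhsNormSq (gaugeDir W μ x κ) ≤ 4·(L^{j+1})²·Σ_x nhsNormSq (covLapSite W μ x)` over `periodBox (N·L^{j+1})`. [folklore] -/
theorem sum_nhsNormSq_gaugeDir_le_of_mem_avgKernelGauges [Nonempty n] {L N : ℕ} (hL : 2 ≤ L) (hN : 1 ≤ N) (j : ℕ)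
    {W : Site d → Fin d → (Matrix n n ℂ)ˣ} {x : ℝ} (hWu : IsUnitaryCfg W) (hWP : IsPeriodicCfg W ((N * L ^ (j + 1) : ℕ) : ℤ))
    (hx : 0 ≤ x) (hsm : LevelSmall d L j x) (hWx : SmallField W x)
    (hsmall : 8 * d * (((L : ℝ) ^ (j + 1)) * (((d : ℝ) - 1) * (((L : ℝ) ^ (j + 1)) - 1) * x)) ^ 2
      + 2 * (Fintype.card n * (4 * (d : ℝ) ^ 2 * ((L : ℝ) ^ (j + 1) - 1) ^ 2 * x + 16 * d * loopRad d L ((prop1Radius d L)^[j] x)) ^ 2)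
        ≤ 1 / 2)
    {μ : Site d → Matrix n n ℂ} (hμ : μ ∈ avgKernelGauges (d := d) (n := n) L N (j + 1) W) :
    ∑ y ∈ periodBox (d := d) (N * L ^ (j + 1)), ∑ κ : Fin d, nhsNormSq (gaugeDir W μ y κ)
      ≤ 4 * ((L : ℝ) ^ (j + 1)) ^ 2 * ∑ y ∈ periodBox (d := d) (N * L ^ (j + 1)), nhsNormSq (covLapSite W μ y) := by
  obtain ⟨_, hμP, hμ0⟩ := hμ
  have hP : 1 ≤ N * L ^ (j + 1) := Nat.one_le_iff_ne_zero.mpr (Nat.mul_ne_zero (by omega) (pow_ne_zero _ (by omega)))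
  set A := ∑ y ∈ periodBox (d := d) (N * L ^ (j + 1)), ∑ κ : Fin d, nhsNormSq (gaugeDir W μ y κ) with hA
  set B := ∑ y ∈ periodBox (d := d) (N * L ^ (j + 1)), nhsNormSq (covLapSite W μ y) with hB
  set C := ∑ y ∈ periodBox (d := d) (N * L ^ (j + 1)), nhsNormSq (μ y) with hC
  have hA0 : 0 ≤ A := Finset.sum_nonneg fun y _ => Finset.sum_nonneg fun κ _ => nhsNormSq_nonneg _
  have hB0 : 0 ≤ B := Finset.sum_nonneg fun y _ => nhsNormSq_nonneg _
  have hC0 : 0 ≤ C := Finset.sum_nonneg fun y _ => nhsNormSq_nonneg _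
  -- `A = Σ hsR (Δμ) μ ≤ √B·√C`
  have hGP : IsPeriodicDir (gaugeDir W μ) ((N * L ^ (j + 1) : ℕ) : ℤ) := isPeriodicDir_gaugeDir hWP hμP
  have h1 := sum_hsR_gaugeDir hP hWu hGP hμP
  rw [covDiv_gaugeDir_eq_covLapSite] at h1
  have hAeq : A = ∑ y ∈ periodBox (d := d) (N * L ^ (j + 1)), hsR (covLapSite W μ y) (μ y) := by
    rw [hA, ← h1]
    exact Finset.sum_congr rfl fun y _ => Finset.sum_congr rfl fun κ _ => (hsR_self _).symm
  have hACS : A ≤ Real.sqrt B * Real.sqrt C := by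
    rw [hAeq]
    calc ∑ y ∈ periodBox (d := d) (N * L ^ (j + 1)), hsR (covLapSite W μ y) (μ y)
        ≤ ∑ y ∈ periodBox (d := d) (N * L ^ (j + 1)), Real.sqrt (nhsNormSq (covLapSite W μ y)) * Real.sqrt (nhsNormSq (μ y)) :=
          Finset.sum_le_sum fun y _ => (le_abs_self _).trans (abs_hsR_le_nhsNorm _ _)
      _ ≤ Real.sqrt (∑ y ∈ periodBox (d := d) (N * L ^ (j + 1)), Real.sqrt (nhsNormSq (covLapSite W μ y)) ^ 2)
          * Real.sqrt (∑ y ∈ periodBox (d := d) (N * L ^ (j + 1)), Real.sqrt (nhsNormSq (μ y)) ^ 2) :=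
          Real.sum_mul_le_sqrt_mul_sqrt _ _ _
      _ = Real.sqrt B * Real.sqrt C := by
          rw [hB, hC]
          congr 1
          · congr 1
            exact Finset.sum_congr rfl fun y _ => Real.sq_sqrt (nhsNormSq_nonneg _)
          · congr 1
            exact Finset.sum_congr rfl fun y _ => Real.sq_sqrt (nhsNormSq_nonneg _)
  -- K6-Ξ: `C ≤ 4M²·A`
  have hK := sum_nhsNormSq_le_four_mul_of_bmeanIterW_eq_zero hL j hWu hx hsm hWx N μ (fun z _ => by rw [hμ0]; rfl) hsmall
  rw [show L ^ (j + 1) * N = N * L ^ (j + 1) from Nat.mul_comm _ _] at hK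
  have hCA : C ≤ 4 * (((L : ℝ) ^ (j + 1)) ^ 2 * A) := hK
  -- `A ≤ √B·√(4M²A) = 2M·√A·√B` ⟹ `A ≤ 4M²·B`
  have hM0 : 0 ≤ (L : ℝ) ^ (j + 1) := by positivity
  have hsqC : Real.sqrt C ≤ 2 * (L : ℝ) ^ (j + 1) * Real.sqrt A := by
    have h4 : Real.sqrt (4 * (((L : ℝ) ^ (j + 1)) ^ 2 * A)) = 2 * (L : ℝ) ^ (j + 1) * Real.sqrt A := by
      rw [show 4 * (((L : ℝ) ^ (j + 1)) ^ 2 * A) = (2 * (L : ℝ) ^ (j + 1)) ^ 2 * A by ring,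
        Real.sqrt_mul (by positivity) A, Real.sqrt_sq (by positivity)]
    rw [← h4]
    exact Real.sqrt_le_sqrt hCA
  have hAle : A ≤ 2 * (L : ℝ) ^ (j + 1) * Real.sqrt A * Real.sqrt B := by
    calc A ≤ Real.sqrt B * Real.sqrt C := hACS
      _ ≤ Real.sqrt B * (2 * (L : ℝ) ^ (j + 1) * Real.sqrt A) := mul_le_mul_of_nonneg_left hsqC (Real.sqrt_nonneg _)
      _ = 2 * (L : ℝ) ^ (j + 1) * Real.sqrt A * Real.sqrt B := by ring
  have hsqA : Real.sqrt A ≤ 2 * (L : ℝ) ^ (j + 1) * Real.sqrt B := by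
    by_cases hA0' : Real.sqrt A = 0
    · rw [hA0']; positivity
    · have hpos : 0 < Real.sqrt A := lt_of_le_of_ne (Real.sqrt_nonneg _) (Ne.symm hA0')
      have h2 : Real.sqrt A * Real.sqrt A ≤ (2 * (L : ℝ) ^ (j + 1) * Real.sqrt B) * Real.sqrt A := by
        rw [Real.mul_self_sqrt hA0]; linarith [hAle]
      exact le_of_mul_le_mul_right h2 hpos
  calc A = Real.sqrt A ^ 2 := (Real.sq_sqrt hA0).symm
    _ ≤ (2 * (L : ℝ) ^ (j + 1) * Real.sqrt B) ^ 2 := by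
        exact pow_le_pow_left₀ (Real.sqrt_nonneg _) hsqA 2
    _ = 4 * ((L : ℝ) ^ (j + 1)) ^ 2 * B := by rw [mul_pow, mul_pow, Real.sq_sqrt hB0]; ring

/-- **THE EXACT PART OF A (1.38)-LANDAU DIRECTION AGAINST ANY COMPETITOR WITH THE SAME NESTED BLOCK MEANS** (module docstring (ii)): for a unitary periodic `W` of the
class, `Y = η + D_W ζ` with `covDiv W η = 0` on the period box and `IsLandauB8 L N (j+1) W Y`, and every `ũ` with `ũ − ζ ∈ avgKernelGauges L N (j+1) W`:
`Σ_{x,κ} nhsNormSq (D_W ζ) ≤ 2·Σ_{x,κ} nhsNormSq (D_W ũ) + 32·(L^{j+1})²·Σ_x nhsNormSq (Δ_W ũ)`. [folklore] -/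
theorem sum_nhsNormSq_gaugeDir_le_of_isLandauB8 [Nonempty n] {L N : ℕ} (hL : 2 ≤ L) (hN : 1 ≤ N) (j : ℕ)
    {W : Site d → Fin d → (Matrix n n ℂ)ˣ} {x : ℝ} (hWu : IsUnitaryCfg W) (hWP : IsPeriodicCfg W ((N * L ^ (j + 1) : ℕ) : ℤ))
    (hx : 0 ≤ x) (hsm : LevelSmall d L j x) (hWx : SmallField W x)
    (hsmall : 8 * d * (((L : ℝ) ^ (j + 1)) * (((d : ℝ) - 1) * (((L : ℝ) ^ (j + 1)) - 1) * x)) ^ 2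
      + 2 * (Fintype.card n * (4 * (d : ℝ) ^ 2 * ((L : ℝ) ^ (j + 1) - 1) ^ 2 * x + 16 * d * loopRad d L ((prop1Radius d L)^[j] x)) ^ 2)
        ≤ 1 / 2)
    {Y η : Site d → Fin d → Matrix n n ℂ} {ζ : Site d → Matrix n n ℂ} (hYP : IsPeriodicDir Y ((N * L ^ (j + 1) : ℕ) : ℤ))
    (hsplit : ∀ (y : Site d) (κ : Fin d), Y y κ = η y κ + gaugeDir W ζ y κ)
    (hη : ∀ y ∈ periodBox (d := d) (N * L ^ (j + 1)), covDiv W η y = 0)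
    (hLan : IsLandauB8 (d := d) L N (j + 1) W Y)
    {u : Site d → Matrix n n ℂ} (hu : (fun y => u y - ζ y) ∈ avgKernelGauges (d := d) (n := n) L N (j + 1) W) :
    ∑ y ∈ periodBox (d := d) (N * L ^ (j + 1)), ∑ κ : Fin d, nhsNormSq (gaugeDir W ζ y κ)
      ≤ 2 * ∑ y ∈ periodBox (d := d) (N * L ^ (j + 1)), ∑ κ : Fin d, nhsNormSq (gaugeDir W u y κ)
        + 32 * ((L : ℝ) ^ (j + 1)) ^ 2 * ∑ y ∈ periodBox (d := d) (N * L ^ (j + 1)), nhsNormSq (covLapSite W u y) := by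
  have hP : 1 ≤ N * L ^ (j + 1) := Nat.one_le_iff_ne_zero.mpr (Nat.mul_ne_zero (by omega) (pow_ne_zero _ (by omega)))
  set μ : Site d → Matrix n n ℂ := fun y => u y - ζ y with hμdef
  have hsum : ζ + μ = u := by funext y; simp only [Pi.add_apply, hμdef]; abel
  -- `D_W ζ = D_W u − D_W μ`, `Δ_W μ = Δ_W u − Δ_W ζ`
  have hDζ : ∀ (y : Site d) (κ : Fin d), gaugeDir W ζ y κ = gaugeDir W u y κ - gaugeDir W μ y κ := by
    intro y κ
    have h := gaugeDir_add_pi W ζ μ y κ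
    rw [hsum] at h
    rw [h]; abel
  have hΔμ : ∀ y : Site d, covLapSite W μ y = covLapSite W u y - covLapSite W ζ y := by
    intro y
    have h := congrFun (covLapSite_add W ζ μ) y
    rw [hsum, Pi.add_apply] at h
    rw [h]; abel
  -- the three inequalities
  have h1 : ∑ y ∈ periodBox (d := d) (N * L ^ (j + 1)), ∑ κ : Fin d, nhsNormSq (gaugeDir W ζ y κ)
      ≤ 2 * ∑ y ∈ periodBox (d := d) (N * L ^ (j + 1)), ∑ κ : Fin d, nhsNormSq (gaugeDir W u y κ)
        + 2 * ∑ y ∈ periodBox (d := d) (N * L ^ (j + 1)), ∑ κ : Fin d, nhsNormSq (gaugeDir W μ y κ) := by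
    rw [Finset.mul_sum, Finset.mul_sum, ← Finset.sum_add_distrib]
    refine Finset.sum_le_sum fun y _ => ?_
    rw [Finset.mul_sum, Finset.mul_sum, ← Finset.sum_add_distrib]
    refine Finset.sum_le_sum fun κ _ => ?_
    rw [hDζ y κ]
    have := nhsNormSq_sub_le (gaugeDir W u y κ) (gaugeDir W μ y κ)
    linarith
  have h2 := sum_nhsNormSq_gaugeDir_le_of_mem_avgKernelGauges hL hN j hWu hWP hx hsm hWx hsmall hu
  have hmin := sum_nhsNormSq_covLapSite_le_of_isLandauB8 hP hWu hWP hYP hsplit hη hLan hu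
  rw [hsum] at hmin
  have h3 : ∑ y ∈ periodBox (d := d) (N * L ^ (j + 1)), nhsNormSq (covLapSite W μ y)
      ≤ 4 * ∑ y ∈ periodBox (d := d) (N * L ^ (j + 1)), nhsNormSq (covLapSite W u y) := by
    have h3a : ∑ y ∈ periodBox (d := d) (N * L ^ (j + 1)), nhsNormSq (covLapSite W μ y)
        ≤ 2 * ∑ y ∈ periodBox (d := d) (N * L ^ (j + 1)), nhsNormSq (covLapSite W u y)
          + 2 * ∑ y ∈ periodBox (d := d) (N * L ^ (j + 1)), nhsNormSq (covLapSite W ζ y) := by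
      rw [Finset.mul_sum, Finset.mul_sum, ← Finset.sum_add_distrib]
      refine Finset.sum_le_sum fun y _ => ?_
      rw [hΔμ y]
      have := nhsNormSq_sub_le (covLapSite W u y) (covLapSite W ζ y)
      linarith
    linarith
  have hM2 : 0 ≤ 4 * ((L : ℝ) ^ (j + 1)) ^ 2 := by positivity
  calc ∑ y ∈ periodBox (d := d) (N * L ^ (j + 1)), ∑ κ : Fin d, nhsNormSq (gaugeDir W ζ y κ)
      ≤ 2 * ∑ y ∈ periodBox (d := d) (N * L ^ (j + 1)), ∑ κ : Fin d, nhsNormSq (gaugeDir W u y κ)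
        + 2 * (4 * ((L : ℝ) ^ (j + 1)) ^ 2 * ∑ y ∈ periodBox (d := d) (N * L ^ (j + 1)), nhsNormSq (covLapSite W μ y)) := by
          linarith
    _ ≤ 2 * ∑ y ∈ periodBox (d := d) (N * L ^ (j + 1)), ∑ κ : Fin d, nhsNormSq (gaugeDir W u y κ)
        + 2 * (4 * ((L : ℝ) ^ (j + 1)) ^ 2 * (4 * ∑ y ∈ periodBox (d := d) (N * L ^ (j + 1)), nhsNormSq (covLapSite W u y))) := by
          have := mul_le_mul_of_nonneg_left h3 hM2
          linarith
    _ = _ := by ring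

end

end Summit.QuantumFields.BalabanUV.T4Continuum.NE3.SlicB8LandauReduction
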